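import Mathlib
import HarnessLib
import HarnessLib.Audit
import Summits.AtomisticToContinuum.Statement
import Literature.MathematicalPhysics.KineticTheory.InfiniteChainDynamics
import Literature.MathematicalPhysics.KineticTheory.InfiniteChainInvariantStates
import Summits.AtomisticToContinuum.FouriersLaw.Theorems.EmbeddedDrudeMourreNessUnique
import Summits.AtomisticToContinuum.FouriersLaw.Theorems.FourierGreenKuboFourierFiniteResponseOfUnique
import Summits.AtomisticToContinuum.FouriersLaw.Theorems.PuiseuxTransferLedgerFiniteResponseProfile
import Summits.AtomisticToContinuum.FouriersLaw.Theorems.ContactEchoEpochsPinnedSteadyStateExists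
import HarnessLib.Audit.Status.Attr

/-!
Route: LocalOhmBV

# Route LocalOhmBV — local Ohm inequality × BV kinetic-temperature response profile ⇒ bounded
response ⇒ Fourier; Mazur loophole certified shut by the Toda-type lattice classification

X_LO (LOCAL OHM × BV-PROFILE line; realises idea card conservation-law-rigidity-local-ohm;
conforming re-filing of the retired gen-0 route
LocalOhmRigidity, whose assembly did not conclude the Statement decl). For pinnedChain ω₂ lam β γ
(all four parameters > 0), every T > 0,
in the Bonetto–Lebowitz–Rey-Bellet order of limits (δ = T_L − T_R → 0 at fixed N first, then N → ∞),
with weak-NESS uniqueness as a shared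
support item, write D_N = lim_{δ→0} totalCurrent(μ_{N,T+δ/2,T−δ/2})/δ (clause (ii) of
FouriersLawFor), g_N = D_N/(N−1) the per-bond
current response and θ_N(i) = lim_{δ→0} (μ_{N,T+δ/2,T−δ/2}(p_i²) − μ_{N,T,T}(p_i²))/δ the
kinetic-temperature response profile.
It suffices to show X = LocalOhm ∧ BVProfile ∧ BoundedResponseConverges on top of the finite-N
infrastructure (NessUnique,
FiniteResponseOfUnique, FiniteResponseProfile) and one finite-sum glue (LocalOhmGlue):
(LocalOhm, rank 2) ∃ C, ℓ, b independent of N: at every bulk bond x (b ≤ x ≤ N−b−2), |g_N| ≤ C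
Σ_{|i−x|≤ℓ} |θ_N(i+1) − θ_N(i)| — "no
current without a local temperature gradient", an N-uniform LOCAL upper bound on the conductivity;
(BVProfile, rank 3) sup_N Σ_i
|θ_N(i+1) − θ_N(i)| < ∞ — no wasted gradient; summing LocalOhm over the N−2b−1 bulk bonds against
BVProfile gives
(N−2b−1)|g_N| ≤ C(2ℓ+1)·TV(θ_N), i.e. sup_N |D_N| < ∞ = length-uniform bounded response (support
BoundedResponse = the catalogued
necessary waypoint HasBoundedResponse written out); (BoundedResponseConverges, rank 4, import slot
shared with OddSectorIrreversibility)
a bounded response sequence converges to a positive limit; then κ(T) := lim D_N ∈ (0, ∞) and, with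
clause (i) from the support item
PinnedSteadyStateExists (shared stmt-AtomisticToContinuum-9900: existence, PROVED in tree as
pinnedChain_exists_isSteadyState) + NessUnique,
FouriersLaw (deciding theorem `closes`, sorry-free, planner-checked rc 0; cone repair 2026-08-15: 8
hypotheses).
Lean: `NessUnique ∧ PinnedSteadyStateExists ∧ FiniteResponseOfUnique ∧ FiniteResponseProfile ∧
LocalOhm ∧ BVProfile ∧ LocalOhmGlue ∧ BoundedResponseConverges`

## Assembly
Logic plus one finite sum (the deciding theorem `closes : LocalOhmGlue → NessUnique →
PinnedSteadyStateExists → FiniteResponseOfUnique →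
FiniteResponseProfile → LocalOhm → BVProfile → BoundedResponseConverges → FouriersLaw`, ~75 lines,
rc 0 in the planner's Sketch.lean /
ConeProbe3.lean, axioms propext / Classical.choice / Quot.sound): clause (i) from the support item
PinnedSteadyStateExists (all N; shared
stmt-9900, PROVED in tree as pinnedChain_exists_isSteadyState — an ITEM since the 2026-08-15 cone
repair so that this Theses file does not
import the Langevin-SDE proof cone LangevinChainNESSHolds) + NessUnique; canonical family μ₀ by
Classical.choose; D₀(T, N) from FiniteResponseOfUnique; BddAbove from LocalOhmGlue (LocalOhm summed
over
bulk bonds × BVProfile, profiles from FiniteResponseProfile); BoundedResponseConverges ⇒ D₀(T, ·) →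
k(T) > 0; κ T := k(T) for T > 0 (else 1);
any other steady-state family has the same difference quotients for |δ| < 2T by uniqueness
(Filter.Tendsto.congr'). The Assembly item below
omits the glue antecedent: it is exactly `closes` once LocalOhmGlue is proved (planner theorem
assembly_of_glue : LocalOhmGlue → Assembly, rc 0;
restated 2026-08-15 with PinnedSteadyStateExists as its second antecedent, matching `closes`).

Rationale: WHY THIS LINE. Every proof of FouriersLaw must pass through length-uniform boundedness of the
finite-size conductivity (HasBoundedResponse; necessity
proved in tree, hasBoundedResponse_of_fouriersLawFor), and the open routes reach it through
L²/variance objects (OddSectorIrreversibility: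
odd part of the response density; CurrentTiltQuench: Doob-tilted states) or time-correlation decay
(FourierGreenKubo); this line attacks it
WITHOUT time decay and without L² structure, as a Liouville-type statement about the linear-response
steady state read through its spatial
PROFILE: an N-uniform LOCAL upper bound on the conductivity (LocalOhm) times a REGULARITY statement
(BVProfile, O(1) total variation), whose
product is sup_N |D_N| < ∞ by a finite sum (BonettoLebowitzReyBellet2000 §5.3 (33), §6.3; card
conservation-law-rigidity-local-ohm).
The structural half is TRUE at the integrable corner (RiederLebowitzLieb1967, Nakazawa1970: flat
bulk, geometric boundary layers) and all
anharmonic content sits in LocalOhm, which is FALSE there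
(HarmonicChainBallisticFlux.not_hasBoundedResponse) — so refuters and provers
work on one inequality. The intended proof of LocalOhm is compactness + odd-sector rigidity, the
Eyink–Lebowitz–Spohn architecture
(EyinkLebowitzSpohn1991, doi:10.1007/bf02278011) linearised around μ_T with the deterministic input
cut down to the ODD sector of
macro-ergodicity (FritzFunakiLebowitz1994 Thm 2.2, Bernardin2014 Def. 1; support
ZeroCurrentRigidity, shared in substance with
CurrentTiltQuench.BoundedOddRigidity), and the conservation-law loophole (Mazur1969, Zotos2002,
ProsenCampbell2000) is closed at the local
level by a certificate imported from the symmetry-approach classification of Toda-type lattices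
(Yamilov2006; Levi in
book:clarkson1999-symmetries-integrability-difference-equations pp. 263–273, Thms 1–3 p. 271;
Levi–Winternitz–Yamilov doi:10.1090/crmm/038;
support NoLocalIntegrals), whose first canonical condition this planner evaluated by hand — it fails
for every β > 0 (see Cheapest falsifier).
Imported areas: hydrodynamic-limit rigidity theory (dictionary: regular invariant state ↦ window
limit of the NESS response, macro-ergodicity
↦ its odd sector only, one-block estimate ↦ LocalOhm) and the integrable-systems classification of
lattice equations; no physical analogy.
Versus the retired gen-0 filing: a PROVED deciding theorem `closes` onto the Statement decl
`FouriersLaw`, no Barriers predicate in the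
decl cone (HasBoundedResponse written out; infinite-chain vocabulary from the fact-free
KineticTheory files), and the rigidity/certificate
statements re-ranked to support because they are kill tests and inputs of LocalOhm's future split,
not inputs of the glue.

RANKED CRUXES. #2 LocalOhm (crux) — LOCAL OHM INEQUALITY (card crux 1) — 'no current without a local
kinetic-temperature gradient', uniformly in N: for pinnedChain ω₂ lam β γ (all > 0), T > 0, under
weak-NESS uniqueness, along any steady-state family there are C, a window radius ℓ and an excluded
boundary width b (depending on the parameters and T, NOT on N) such that for every N, every response
coefficient d = D_N (clause-(ii) limit) and every kinetic-temperature response profile θ = θ_N, at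
every bulk bond x (b ≤ x ≤ N−b−2): |d|/(N−1) ≤ C · Σ_{bonds (i,i+1), |i−x| ≤ ℓ} |θ(i+1) − θ(i)|
(d/(N−1) = per-bond current response, all bond currents agreeing in a steady state). A LOCAL,
N-uniform upper bound on the conductivity; with local equilibrium it holds with C ≈ κ(T), ℓ = 0;
false for the harmonic chain (flat bulk profile, O(1) current). Intended proof: interior compactness
of the normalised first-order response densities on bulk windows + linearised odd-sector rigidity
(planned split, tenure). [difficulty: XL] (why it might fail: No interior a-priori estimate for the
linearised stationary equation of a pure-transport bulk: window limits of the normalised response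
may not exist or lose locality; kinetic temperature may be the wrong local field; flat
current-carrying bulk windows (plateaus, cf. arXiv:1610.06076) falsify it.)
[BonettoLebowitzReyBellet2000, Bernardin2014, EyinkLebowitzSpohn1991, RiederLebowitzLieb1967,
LepriLiviPoliti2003, Dhar2008, arXiv:1610.06076]
#3 BVProfile (crux) — BOUNDED VARIATION OF THE KINETIC-TEMPERATURE RESPONSE PROFILE (card crux 3):
under weak-NESS uniqueness, along any steady-state family, for T > 0 there is C (parameters, T) with
Σ_i |θ_N(i+1) − θ_N(i)| ≤ C for every N and every response profile θ_N (same difference quotients as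
in LocalOhm; vacuous where they have no limit). Prettier sufficient form: θ_N monotone for N ≥ N₀ —
then TV = θ_N(0) − θ_N(N−1) = 1 − 2g_N/γ ≤ 1 by the bath identities γ(1/2 − θ_N(0)) = g_N =
γ(θ_N(N−1) + 1/2). TRUE at the integrable corner (Rieder–Lebowitz–Lieb/Nakazawa: flat bulk,
geometric boundary layers, TV = O(1)); converts local to global: summing LocalOhm over bulk bonds,
each bond in ≤ 2ℓ+1 windows, gives (N−2b−1)|D_N|/(N−1) ≤ C(2ℓ+1)·TV(θ_N). Caveat: model-specific
among ballistic chains — the alternating-mass harmonic chain has a period-2 bulk oscillation, TV ≍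
N. [difficulty: L] (why it might fail: Needs a comparison / maximum-principle structure the Langevin
chain is not known to have (only the global sign of the flux is proved, EPR1999b); boundary layers
of width ~ mean free path ~ (lam T)⁻² may oscillate with slow decay; TV ≍ N for alternating-mass
harmonic chains.) [RiederLebowitzLieb1967, Nakazawa1970, EckmannPilletReyBellet1999b,
doi:10.1103/physreve.85.041118, Dhar2008, AokiKusnezov2000]
#4 BoundedResponseConverges (crux) — IMPORT SLOT (verbatim stmt-AtomisticToContinuum-9141 of route
OddSectorIrreversibility = moot 2741 of LocalOhmRigidity; dedup attaches this route): under
uniqueness, along any steady-state family and T > 0, if the response coefficients D_N of clause (ii)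
exist and (|D_N|) is bounded then D_N → k for some k > 0 — 'FouriersLawFor minus bounded response',
a consequence of the conjunct under uniqueness (uniqueness of limits along 𝓝[≠]0), expected from the
Fekete card (quasi-subadditive resistance + positive conductance) or from FourierGreenKubo's
ThermodynamicLimit; NOT this route's mechanism — the declared residual once bounded response is in
hand. [difficulty: L] (why it might fail: Half of Fourier's law itself: D_N may stay bounded yet
oscillate in N (no monotonicity/subadditivity in the length is known; size resonances at low T, mean
free path ≍ (lam T)⁻² > N) or tend to 0 (no N-uniform lower bound on the conductance beyond μ(Φ) > 0
at fixed N).) [BonettoLebowitzReyBellet2000, EckmannPilletReyBellet1999b, LepriLiviPoliti2003,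
AokiLukkarinenSpohn2006, BricmontKupiainen2007]
#9 NessUnique (support) — (verbatim stmt-AtomisticToContinuum-0741, shared with FourierGreenKubo /
OddSectorIrreversibility / CurrentTiltQuench) uniqueness of the weak steady state (IsSteadyState
class) of pinnedChain at every N, T_L, T_R > 0 — the uniqueness half of clause (i); existence is the
support item PinnedSteadyStateExists. [difficulty: L] [CuneoEckmannHairerReyBellet2018, Carmona2007]
#9 PinnedSteadyStateExists (support) — (verbatim stmt-AtomisticToContinuum-9900, shared with
HeatModeWeylLaw / ProfileLadder / FeketeSeriesLaw a.o.; cone repair 2026-08-15) CLAUSE (i)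
EXISTENCE: for pinnedChain (all parameters > 0), every N and T_L, T_R > 0 a weak steady state
(IsSteadyState) exists. PROVED in tree as pinnedChain_exists_isSteadyState
(LangevinChainNESSHolds.lean); a Theorems file importing it closes the item in one line. An ITEM
(hypothesis hEX of `closes`) so that the Theses file drops `import LangevinChainNESSHolds` and its
≈55-module Langevin-SDE proof cone. [difficulty: provable-now] [CuneoEckmannHairerReyBellet2018]
#9 FiniteResponseOfUnique (support) — (verbatim stmt-AtomisticToContinuum-0717, shared) under
uniqueness, along any steady-state family, the finite-N linear-response limit D_N(T) = lim_{δ→0,δ≠0}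
totalCurrent(μ_{N,T+δ/2,T−δ/2})/δ exists for every T > 0 and N (Hairer–Majda / Rey-Bellet
differentiability at equilibrium). [difficulty: M] [HairerMajda2009, ReyBellet2003,
CuneoEckmannHairerReyBellet2018]
#9 FiniteResponseProfile (support) — (card support 5) EXISTENCE OF THE KINETIC-TEMPERATURE RESPONSE
PROFILE: under uniqueness, for every steady-state family, T > 0, N and site i, δ ↦
(μ_{N,T+δ/2,T−δ/2}(p_i²) − μ_{N,T,T}(p_i²))/δ has a limit θ_N(i) as δ → 0, δ ≠ 0 — the same
differentiability-at-equilibrium content as FiniteResponseOfUnique for the polynomial observable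
p_i² (p_i² ∈ L¹ of the true NESS since e^{ϑH} is, CEHR2018 Thm 2.13(2)). Needed to instantiate θ_N
in LocalOhm/BVProfile (else they are vacuous). N = 0: no sites. [difficulty: M] [HairerMajda2009,
ReyBellet2003, BonettoLebowitzReyBellet2000]
#9 BoundedResponse (support) — (verbatim stmt-AtomisticToContinuum-10924 of
OddSectorIrreversibility, shared) THE ROUTE'S DELIVERABLE = the catalogued necessary waypoint
`Literature.Barriers.AtomisticToContinuum.HasBoundedResponse (pinnedChain ω₂ lam β γ)` under
weak-NESS uniqueness, WRITTEN OUT (definiens verbatim; hasBoundedResponse_iff is Iff.rfl, so provers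
may still use hasBoundedResponse_iff_of_unique, PROVED, by importing
FixedLengthNoConductivityControl in their Theorems file; the Barriers predicate is not named so that
the staffability audit sees no cite-only dependency): for all parameters > 0, along EVERY
steady-state family and every T > 0, if D_N exists for all N then (|D_N|)_N is bounded. Closed here
by LocalOhmGlue; fails at lam = β = 0. [difficulty: M] [BonettoLebowitzReyBellet2000,
BonettoLebowitzLukkarinenOlla2009,
Literature.Barriers.AtomisticToContinuum.hasBoundedResponse_iff_of_unique]
#9 LocalOhmGlue (support) — GLUE (finite sums, ~60 Lean lines; the ONE sufficiency the deciding
theorem consumes): FiniteResponseProfile → LocalOhm → BVProfile → BoundedResponse. Given parameters,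
uniqueness, a family μ, T > 0 and response coefficients D with the clause-(ii) limits: pick θ_N from
FiniteResponseProfile (choice over i : Fin N); from LocalOhm get C, ℓ, b; for N ≥ 4b + 2 sum the
LocalOhm inequality over the bulk bonds x = b, …, N−b−2: (N−2b−1)|D_N|/(N−1) ≤ C Σ_x Σ_{|i−x|≤ℓ}
|θ_N(i+1) − θ_N(i)| ≤ max(C,0)(2ℓ+1) Σ_i |θ_N(i+1) − θ_N(i)| ≤ max(C,0)(2ℓ+1)·C_BV (each bond lies
in at most 2ℓ+1 windows; BVProfile), hence |D_N| ≤ 2 max(C,0)(2ℓ+1) C_BV; the finitely many N < 4b +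
2 contribute a finite maximum; so BddAbove (range |D_N|). Arithmetic re-derived by two refuter
reviews of the gen-0 filing. [difficulty: provable-now] [folklore, BonettoLebowitzReyBellet2000]
#9 ZeroCurrentRigidity (support) — ZERO-CURRENT (ODD-SECTOR) RIGIDITY OF THE INFINITE CHAIN — the
rigidity input of LocalOhm's planned split and the line's kill test (a); NOT consumed by `closes`
(re-ranked from crux to support after the gen-0 review). For ω₂, lam, β > 0 (γ inert), every
probability measure ν on (ℝ×ℝ)^ℤ that is shift-invariant, time-invariant for the infinite
deterministic pinned chain in the generator sense (∫𝒜f dν = 0, f ∈ C₀¹, 𝒜f ν-integrable) and regular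
(box relative entropy ≤ C|Λ| w.r.t. a Gibbs state) — decls IsShiftInvariant / IsTimeInvariant /
IsRegular of Literature.MathematicalPhysics.KineticTheory.InfiniteChainInvariantStates (fact-free
vocabulary) — and integrates j_0 = bondCurrentZ σ 0, has ∫ j_0 dν = 0. Verbatim the consequent of
CurrentTiltQuench.OddRigidityTransfer (so a proof of CurrentTiltQuench.BoundedOddRigidity closes
it); strictly weaker than MacroErgodicityHypothesis (odd sector only); false at lam = β = 0
(SpohnLebowitz1977). Open problem; idle provers should NOT start here. [difficulty: open-problem]
[FritzFunakiLebowitz1994, Bernardin2014, SpohnLebowitz1977, Mazur1969, Zotos2002]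
#9 NoLocalIntegrals (support) — NO LOCAL CONSERVATION LAW BESIDES ENERGY (card support 4; the
certificate closing Mazur's loophole at the local level and the certified form of kill test (b); NOT
consumed by `closes`): for ω₂, lam, β > 0, every smooth local density f on (ℝ×ℝ)^ℤ (f = g ∘
boxRestrict R, g ∈ C^∞) whose Liouville derivative is a total difference, liouvilleZ P f = ψ − ψ ∘
shift with ψ smooth local, is of the form c·e_0 + (h − h ∘ shift) + k with e_0 = p_0²/2 + U(q_0) +
V(q_1 − q_0), h smooth local, c, k constants. Method: the symmetry approach to Toda-type lattices
u_{n,tt} = F(u_{n−1}, u_n, u_{n+1}) (Levi 1999 class (1.1), Thms 1–3 p. 271; Yamilov2006;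
Levi–Winternitz–Yamilov 2022): a conservation law of order ≥ 3 forces the canonical conditions, and
the first one, (4.9) 'D_t log ∂F/∂u_{n+1} ∈ Im(D−1)', FAILS for V″(r) = 1 + 3βr² (planner hand
computation: momentum Euler derivative φ(r_{n−1}) − φ(r_n) ≢ 0, φ = (log V″)′); orders ≤ 2 by direct
computation (pinning kills momentum; quadratic densities reduce to the harmonic case). Vocabulary:
boxRestrict / shift / liouvilleZ of InfiniteChainInvariantStates. False at lam = β = 0 (infinitely
many quadratic conservation laws). [difficulty: L] [Yamilov2006,
book:clarkson1999-symmetries-integrability-difference-equations, doi:10.1090/crmm/038,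
doi:10.1063/1.532230, Mazur1969]

TWO-LAYER PLAN. Foreseen glued splits (nothing filed now; D-0019 k ≤ 3, depth 1): LocalOhm ⇐
InteriorCompactness → OddSectorRigidityLin → LocalOhm, where
InteriorCompactness = windowed a-priori bounds + subsequential window limits of the normalised
first-order response densities f_N/g_N
(the missing 'Caccioppoli' estimate for a pure-transport bulk) and OddSectorRigidityLin = the
linearised, first-order form of
ZeroCurrentRigidity (no translation-covariant, 𝒜-invariant, regular first-order perturbation of μ_T
is odd under p ↦ −p; Drude weight zero
WITH completeness, Doyon2022 template) — needs two definition requests filed with the split;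
BVProfile ⇐ MonotoneProfile (k = 1, the
maximum-principle strengthening, using the exact bath identities γ(1/2 − θ_N(0)) = g_N = γ(θ_N(N−1)
+ 1/2)). BoundedResponseConverges is
other routes' business (Fekete card; FourierGreenKubo.ThermodynamicLimit); by dedup (stmt-9141) a
proof there closes it here.

KILL CRITERIA. (a) ¬ZeroCurrentRigidity — a regular, shift-invariant, generator-invariant state of
the infinite anharmonic pinned chain with nonzero mean
current (equivalently ¬CurrentTiltQuench.BoundedOddRigidity): the rigidity mechanism behind LocalOhm
is dead; if the witness comes from a
conserved charge, Mazur1969_inequality.tendsto_integral_atTop makes every Green–Kubo line diverge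
too — close `refuted:ZeroCurrentRigidity`
unless LocalOhm has meanwhile been proved by other means. (b) ¬NoLocalIntegrals with an explicit
extra local conserved density at some
(ω₂, lam, β) > 0 — a candidate integrable member: the conjunct quantifies over ALL positive
parameters, so the route flips into a
refutation attempt of FouriersLaw (Mazur) and is closed `refuted:NoLocalIntegrals` as a conductivity
line. (c) ¬BVProfile (kit MD: TV(θ_N)
growing with N at fixed T, or a proof): pivot once — replace BV by the weaker profile norm that the
data support (e.g. Σ_i w_i|∇θ_N| with
boundary weights) matched with a correspondingly windowed LocalOhm, keeping the product structure;
if no such pair survives, close.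
(d) ¬LocalOhm (flat current-carrying bulk windows for infinitely many N): close `refuted:LocalOhm` —
the line is exactly this inequality.
(e) ¬NessUnique refutes clause (i) of the conjunct itself (then ¬FouriersLaw is the theorem and
every FouriersLaw route closes).
(f) Mooting: BoundedResponse proved elsewhere (OddSectorIrreversibility.OddSufficiency chain,
BondHeatUncertainty) moots cruxes 2–3 but the
route still needs its import slot; FouriersLaw proved by FourierGreenKubo moots everything.

NOT DECOMPOSED YET. The constants C, ℓ, b, C_BV and their T-dependence (allowed to blow up as T → 0:
LowTemperatureWeakAnharmonicity; ℓ ~ mean free path);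
the interior-compactness lemma and the linearised odd-sector rigidity with their two definitions
(layer-2 children of LocalOhm, filed at the
split); the monotone-profile strengthening and the bath identities (children of BVProfile); the
order-by-order bookkeeping of
NoLocalIntegrals (orders ≤ 2 by hand, ≥ 3 by the classification; point-transformation normal forms);
the mechanisms behind
BoundedResponseConverges (Fekete / Green–Kubo, other routes); any N → ∞-first (fixed small δ)
variant of the compactness step, where the
measure-level ZeroCurrentRigidity applies directly but an exchange-of-limits statement would be
owed.

CHEAPEST FALSIFIER. The first canonical integrability condition of the Toda-type classification
(Levi 1999, book:clarkson1999-symmetries-integrability-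
difference-equations p. 271, Thm 1 / condition (4.9); Yamilov2006) — RUN BY HAND in this session:
for F = −U′(u_n) + V′(u_{n+1} − u_n) −
V′(u_n − u_{n−1}), ∂F/∂u_{n+1} = V″(r_n) = 1 + 3βr_n² (r_n = u_{n+1} − u_n); (4.9) asks D_t log
V″(r_n) = φ(r_n)(p_{n+1} − p_n),
φ = (log V″)′ = 6βr/(1 + 3βr²), to be a total difference (D − 1)q_n; its momentum Euler derivative
Σ_k D^{−k} ∂/∂p_{n+k} equals
φ(r_{n−1}) − φ(r_n) ≢ 0 for β ≠ 0, so (4.9) FAILS for every β > 0, all ω₂, lam (and at β = 0 < lam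
the next condition (4.10) fails through
U‴ = 6 lam u ≠ 0): no generalized symmetry of order ≥ 2, no integrable member of the family, no flip
to a refutation — the line stands.
Second cheapest (not run; no kit in the plancard budget): nonequilibrium MD of pinnedChain (ω₂ = lam
= β = γ = 1; T = 1 and 0.05;
N ≤ 256): BVProfile dies if TV(θ_N) grows with N; LocalOhm is calibrated (ℓ, C) or dies on flat
current-carrying bulk windows.

NUMBERS. Harmonic corner (lam = β = 0): D_N = (N−1)c_N with c_N → c_∞ > 0 (RiederLebowitzLieb1967;
HarmonicChainBallisticFlux), bulk kinetic profile
flat, boundary deviations geometric ⇒ TV(θ_N) = O(1) while LocalOhm fails. Expected anharmonic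
picture (LepriLiviPoliti2003 §6, Dhar2008
§2.2, AokiKusnezov2000): g_N ≈ κ(T)/(N−1 + 2R_c) with contact resistance R_c = O(1), bulk
θ-differences ≈ −g_N/κ(T), so LocalOhm with
C ≈ κ(T)·(2ℓ+1)⁻¹·O(1) and BV with C_BV ≤ 1 (monotone); low-T kinetic regime κ(T) ∝ (lam T)⁻² up to
the scaling conjugacy
(AokiLukkarinenSpohn2006; LowTemperatureWeakAnharmonicity), so ℓ, b must grow like the mean free
path as T → 0. Items at open: 11
(3 cruxes, 7 support, 1 assembly); `closes` has 7 hypotheses. After the 2026-08-15 cone repair: 12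
items (8 support incl.
PinnedSteadyStateExists; Assembly restated with it as second antecedent); `closes` has 8 hypotheses.

DEFINITION REQUESTS. None at open — every decl is a one-line Prop over existing vocabulary
(FouriersLaw.lean; InfiniteChainDynamics / InfiniteChainInvariantStates
for ChainConfig, bondCurrentZ, boxRestrict, shift, liouvilleZ, IsShiftInvariant, IsTimeInvariant,
IsRegular). IMPORTS (cone repair 2026-08-15):
only InfiniteChainDynamics + InfiniteChainInvariantStates (fact-free vocabulary; module cone 77 →
23, 17 of them statement-side via the
gate-added Summits.AtomisticToContinuum.Statement); LangevinChainNESSHolds dropped (its one use,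
pinnedChain_exists_isSteadyState in `closes`, is
now the item PinnedSteadyStateExists). Constant-level cone (#h21_route_deps, 51 consts): no unproved
named fact — its [cite]-tagged Props are
predicates (IsSteadyState; via ZeroCurrentRigidity the Bernardin2014 vocabulary IsShiftInvariant /
IsTimeInvariant / IsLocalTestFunction /
IsRegular / IsChainGibbsMeasure / IsGibbsMeasure); every closed [cite] fact left in the module cone
is statement-side or discharged under its
canonical `_holds` (LanfordLebowitzLieb1977_thm1/3_chain, GibbsSpecification / Correlations /
LatticeGraph facts). needs-fact: none. Foreseen with the LocalOhm split
(tenure, not now): `FirstOrderInvariantPerturbation` (translation-covariant, 𝒜-invariant, regular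
first-order perturbations of the infinite
Gibbs state μ_T / extensive-charge space with Drude-weight completeness), topic
Literature/MathematicalPhysics/KineticTheory. Literature wants
filed this session (not blocking): acq-03750 (doi:10.1090/crmm/038, Levi–Winternitz–Yamilov 2022,
Toda-type chapter), acq-03752
(doi:10.1088/0305-4470/39/45/r01, Yamilov 2006 review).

Novelty: Searches (2026-08-15, this planner): `lit search --source zbmath` ×3 ("temperature profile chain
oscillators nonequilibrium": 4 hits incl.
arXiv:1610.06076 De Roeck–Dhar–Huveneers–Schütz step profiles in localized chains; "Toda type
lattice classification conservation laws
symmetries Yamilov": 1 hit doi:10.1090/crmm/038; "temperature profile heat conduction anharmonic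
lattice stationary state": BLLO2009
arXiv:0809.0953, Kupiainen 2009), `--source crossref` ×1 (14 rows, noise), `lit search --hybrid` ×1
(vector leg only, noise), `lit galaxy
search --star all` ×4 ("Toda type lattices": panama Grammaticos–Kosmann-Schwarzbach–Tamizhmani LNP
644 and Euler (ed.) Nonlinear Systems
vol. 3; "symmetries as integrability criteria", "monotonicity of the temperature profile", one long
phrase: 0 relevant), `lit frontier
AtomisticToContinuum --since 2021` (30 rows; heat-conduction rows arXiv:2310.13338
Canestrari–Liverani–Olla 2026 and arXiv:2604.14056
thermally driven HARMONIC chains — neither on profile regularity of anharmonic NESS), `lit bridges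
--cross any` (no heat-conduction bridge),
`lit read book:clarkson1999-symmetries-integrability-difference-equations` pp. 263–273 (Levi: class
(1.1) = our lattice, Thms 1–3 p. 271),
`ledger negatives --problem AtomisticToContinuum` (6, none on FouriersLaw); OpenAlex / S2 / arXiv
API rate-limited this hour; plus the card
author's and two refuter novelty audits' searches (crossref ×7, hybrid ×4, zbmath Shabat–Yamilov
zbl:0722.35006, Adler–Shabat–Yam  [refs: 10.1090/crmm/038, 10.1023/a:1026602012111, 10.1007/bf02278011, 10.1063/1.532230, 1610.06076, 0809.0953, 2310.13338, 2604.14056, doi:10.1090/crmm/038, book:clarkson1999-symmetries-integrability-difference-equations, doi:10.1023/a, doi:10.1007/bf02278011, doi:10.1063/1.532230, EyinkLebowitzSpohn1991, FritzFunakiLebowitz1994, Bernardin2014, Mazur1969, Zotos2002, ProsenCampbell2000, Spohn2014, Yamilov]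

Barriers (technique_class: local-ohm bv-profile odd-sector-rigidity symmetry-approach): - technique_class: local-ohm bv-profile odd-sector-rigidity symmetry-approach
- Literature.Barriers.AtomisticToContinuum.HasBoundedResponse: EMBRACED as the route's deliverable
(support BoundedResponse, written out so the predicate is not in the cone); LocalOhm and BVProfile
are N-UNIFORM statements by construction (C, ℓ, b, C_BV independent of N), not fixed-N tools; the
fixed-N theory enters only through NessUnique / FiniteResponseOfUnique / FiniteResponseProfile.
- Literature.Barriers.AtomisticToContinuum.MacroErgodicityBarrier: APPLIES IN SUBSTANCE and is
engaged head-on — the intended proof of LocalOhm (compactness + rigidity) is the ELS architecture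
linearised around μ_T with input cut to the ODD sector (ZeroCurrentRigidity / its linearised child):
no classification of invariant states, no one- or two-block estimate, no sector condition, nothing
on the diffusive scale; the barrier's scope_caveats name exactly 'regular space-time invariant
states carry zero mean energy current' as what the pinned chain needs at Euler scale. Honest: it
does not fully evade; the bet is that the odd sector is provable where the full classification is
not, and NoLocalIntegrals removes the local-charge obstruction explicitly.
- Literature.Barriers.AtomisticToContinuum.Mazur1969_inequality: this is the ANTI-Mazur line —
absence of conserved charges overlapping J is an explicit item (NoLocalIntegrals: local;
ZeroCurrentRigidity: every tiltable quasi-local charge), not a blind spot; if such a cha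

Novelty grade: new-combination — ROUTE REVIEW (refuter rreview-0815T18-19): KEEP OPEN; full write-up attached as route evidence REVIEW_LocalOhmBV.md. Conforming re-filing of LocalOhmRigidity (retired for D-0027 §2.1 only) ⇒ not a recombination of closed routes; closes native-OK, staffable 0/50. closes + glue read and the finite-sum (refuter refuter-rreview-0815T18-19-0, 2026-08-15T19:31:46Z; prior: BonettoLebowitzReyBellet2000 §5.3/§6.3; EyinkLebowitzSpohn1991; FritzFunakiLebowitz1994 Thm 2.2; Levi 1999 in clarkson1999 pp.263-273 Thms 1-3; doi:10.1090/crmm/038; overlap: route TransferKernelPositivity, ProfileLadder)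

History (route lifecycle, newest last):
- 2026-08-15T20:08:28Z · rev 2: restated Assembly (stmt-AtomisticToContinuum-12075) — route-repair (cone guardrail, gen 2; unit rrepair-AtomisticToContinuum-LocalOhmB-5f5af5d6-g2) 2026-08-15 — RESULT: rerouted: 1 import dropped (LangevinChainNESS (planner-rrepair-AtomisticToContinuum-LocalOhmB-5f5af5d6-g2-0)
- 2026-08-16T02:19:06Z · AUTO-CRUX: 1 conjecture-grade item(s) promoted to crux (ZeroCurrentRigidity) — refuter vetting / tiering apply (operator:999:1362873)

sub-problem: FouriersLaw · status: open · opened planner-plancard-AtomisticToContinuum-Fourier-65a99645-g2-0 2026-08-15T18:48:58Z · rev 2 · ledger route-AtomisticToContinuum-LocalOhmBV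
GENERATED by the gate from the ledger (D-0016/17). Provers cite these decls: `theorem foo : Summit.AtomisticToContinuum.FouriersLaw.Theses.LocalOhmBV.<Decl> := …` in Summits/AtomisticToContinuum/FouriersLaw/Theorems/<Name>.lean.
-/

namespace Summit.AtomisticToContinuum.FouriersLaw.Theses.LocalOhmBV

open scoped BigOperators Topology Manifold Classical MeasureTheory ProbabilityTheory Matrix InnerProductSpace ComplexConjugate ContinuousMap
open Filter Set Function TopologicalSpace MeasureTheory

attribute [summit_statement] _root_.FouriersLaw

/-- item stmt-AtomisticToContinuum-12009 · crux · rank 2 · open · by planner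
why it might fail: No interior a-priori estimate for the linearised stationary equation of a pure-transport bulk: window limits of the normalised response may not exist or lose locality; kinetic temperature may be the wrong local field; flat current-carrying bulk windows (plateaus, cf. arXiv:1610.06076) falsify it.
sources: BonettoLebowitzReyBellet2000, Bernardin2014, EyinkLebowitzSpohn1991, RiederLebowitzLieb1967, LepriLiviPoliti2003, Dhar2008
[crux] [shared verbatim with the local-Ohm line, stmt-AtomisticToContinuum-2738; card item 4
'CornerVersusSlope' in its robust two-sided windowed form] no current without a local
kinetic-temperature gradient, uniformly in N: there are C, a window radius ℓ and an excluded
boundary width b (parameters and T, not N) such that along any steady-state family (under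
uniqueness), for every N, response coefficient d = D_N and response profile θ, at every bulk bond x
(b ≤ x ≤ N−b−2): |d|/(N−1) ≤ C·Σ_{bonds (i,i+1), |i−x|≤ℓ}|θ(i+1) − θ(i)|. Kernel form: the corner
K_N(0,N−1) is at most C × the windowed variation of the column. Engines: comparison of K_N with the
Green's function of an absorbed nearest-neighbour chain with N-uniformly elliptic rates (discrete
Harnack), or interior compactness + odd-sector rigidity (the local-Ohm card). The hardest item;
every anharmonic input of the line sits here (false at lam = β = 0). [deps: FiniteResponseOfUnique,
FiniteResponseProfile] [difficulty: open-problem] -/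
@[route_item "route-AtomisticToContinuum-LocalOhmBV", crux]
def LocalOhm : Prop :=
  ∀ ω₂ lam β γ : ℝ, 0 < ω₂ → 0 < lam → 0 < β → 0 < γ → (∀ (N : ℕ) (T_L T_R : ℝ), 0 < T_L → 0 < T_R → ∀ μ ν : MeasureTheory.Measure (Literature.MathematicalPhysics.KineticTheory.HeatConduction.PhaseSpace N), (Literature.MathematicalPhysics.KineticTheory.HeatConduction.pinnedChain ω₂ lam β γ).IsSteadyState N T_L T_R μ → (Literature.MathematicalPhysics.KineticTheory.HeatConduction.pinnedChain ω₂ lam β γ).IsSteadyState N T_L T_R ν → μ = ν) → ∀ μ : (N : ℕ) → ℝ → ℝ → MeasureTheory.Measure (Literature.MathematicalPhysics.KineticTheory.HeatConduction.PhaseSpace N), (∀ (N : ℕ) (T_L T_R : ℝ), 0 < T_L → 0 < T_R → (Literature.MathematicalPhysics.KineticTheory.HeatConduction.pinnedChain ω₂ lam β γ).IsSteadyState N T_L T_R (μ N T_L T_R)) → ∀ T : ℝ, 0 < T → ∃ (C : ℝ) (ℓ b : ℕ), ∀ (N : ℕ) (d : ℝ) (θ : Fin N → ℝ), Filter.Tendsto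 (fun δ : ℝ => (Literature.MathematicalPhysics.KineticTheory.HeatConduction.pinnedChain ω₂ lam β γ).totalCurrent (μ N (T + δ / 2) (T - δ / 2)) / δ) (nhdsWithin 0 {(0 : ℝ)}ᶜ) (nhds d) → (∀ i : Fin N, Filter.Tendsto (fun δ : ℝ => ((∫ x, (x.2 i) ^ 2 ∂(μ N (T + δ / 2) (T - δ / 2))) - ∫ x, (x.2 i) ^ 2 ∂(μ N T T)) / δ) (nhdsWithin 0 {(0 : ℝ)}ᶜ) (nhds (θ i))) → ∀ x : ℕ, b ≤ x → x + b + 2 ≤ N → |d| / ((N : ℝ) - 1) ≤ C * ∑ i : Fin N, ∑ j : Fin N, (if j.val = i.val + 1 ∧ x ≤ i.val + ℓ ∧ i.val ≤ x + ℓ then |θ j - θ i| else 0)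

/-- item stmt-AtomisticToContinuum-12012 · crux · rank 3 · open · by planner
why it might fail: Needs a comparison / maximum-principle structure the Langevin chain is not known to have (only the global sign of the flux is proved, EPR1999b); boundary layers of width ~ mean free path ~ (lam T)⁻² may oscillate with slow decay; TV ≍ N for alternating-mass harmonic chains.
sources: RiederLebowitzLieb1967, Nakazawa1970, EckmannPilletReyBellet1999b, doi:10.1103/physreve.85.041118, Dhar2008, AokiKusnezov2000
[support] [shared verbatim with stmt-AtomisticToContinuum-2740, crux 4 of the local-Ohm line; in
THIS route the DELIVERABLE of the sign-regularity engine, closed by TPGlue from Passivity +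
MonotoneProfile with C = 2ℓ+1, and the robust fallback form of (M) if pointwise monotonicity dies]
under uniqueness, along any steady-state family, for T > 0 there is C with Σ_i |θ_N(i+1) − θ_N(i)| ≤
C for every N and every response profile θ_N. Not a hypothesis of `closes`. [difficulty: L] -/
@[route_item "route-AtomisticToContinuum-LocalOhmBV", crux]
def BVProfile : Prop :=
  ∀ ω₂ lam β γ : ℝ, 0 < ω₂ → 0 < lam → 0 < β → 0 < γ → (∀ (N : ℕ) (T_L T_R : ℝ), 0 < T_L → 0 < T_R → ∀ μ ν : MeasureTheory.Measure (Literature.MathematicalPhysics.KineticTheory.HeatConduction.PhaseSpace N), (Literature.MathematicalPhysics.KineticTheory.HeatConduction.pinnedChain ω₂ lam β γ).IsSteadyState N T_L T_R μ → (Literature.MathematicalPhysics.KineticTheory.HeatConduction.pinnedChain ω₂ lam β γ).IsSteadyState N T_L T_R ν → μ = ν) → ∀ μ : (N : ℕ) → ℝ → ℝ → MeasureTheory.Measure (Literature.MathematicalPhysics.KineticTheory.HeatConduction.PhaseSpace N), (∀ (N : ℕ) (T_L T_R : ℝ), 0 < T_L → 0 < T_R → (Literature.MathematicalPhysics.KineticTheory.HeatConduction.pinnedChain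 ω₂ lam β γ).IsSteadyState N T_L T_R (μ N T_L T_R)) → ∀ T : ℝ, 0 < T → ∃ C : ℝ, ∀ (N : ℕ) (θ : Fin N → ℝ), (∀ i : Fin N, Filter.Tendsto (fun δ : ℝ => ((∫ x, (x.2 i) ^ 2 ∂(μ N (T + δ / 2) (T - δ / 2))) - ∫ x, (x.2 i) ^ 2 ∂(μ N T T)) / δ) (nhdsWithin 0 {(0 : ℝ)}ᶜ) (nhds (θ i))) → ∑ i : Fin N, ∑ j : Fin N, (if j.val = i.val + 1 then |θ j - θ i| else 0) ≤ C

/-- item stmt-AtomisticToContinuum-9141 · crux · rank 4 · open · by planner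
why it might fail: Half of Fourier's law itself: D_N may stay bounded yet oscillate in N (no monotonicity/subadditivity in the length is known; size resonances at low T, mean free path ≍ (lam T)⁻² > N) or tend to 0 (no N-uniform lower bound on the conductance beyond μ(Φ) > 0 at fixed N).
sources: BonettoLebowitzReyBellet2000, EckmannPilletReyBellet1999b, LepriLiviPoliti2003, AokiLukkarinenSpohn2006, BricmontKupiainen2007
[crux] IMPORT SLOT (verbatim stmt-AtomisticToContinuum-2741 of route LocalOhmRigidity; dedup
attaches this route): under uniqueness, along any steady-state family and T > 0, if the response
coefficients D_N of clause (ii) exist and (|D_N|) is bounded then D_N → k for some k > 0.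
'FouriersLawFor minus HasBoundedResponse'; expected from FeketeResistance
(QuasiSubadditiveResistance + PositiveConductance + FeketeGlue) or FourierGreenKubo's
ThermodynamicLimit — NOT this route's mechanism, declared residual once HasBoundedResponse is in
hand. [difficulty: L] -/
@[route_item "route-AtomisticToContinuum-LocalOhmBV", crux]
def BoundedResponseConverges : Prop :=
  ∀ ω₂ lam β γ : ℝ, 0 < ω₂ → 0 < lam → 0 < β → 0 < γ → (∀ (N : ℕ) (T_L T_R : ℝ), 0 < T_L → 0 < T_R → ∀ μ ν : MeasureTheory.Measure (Literature.MathematicalPhysics.KineticTheory.HeatConduction.PhaseSpace N), (Literature.MathematicalPhysics.KineticTheory.HeatConduction.pinnedChain ω₂ lam β γ).IsSteadyState N T_L T_R μ → (Literature.MathematicalPhysics.KineticTheory.HeatConduction.pinnedChain ω₂ lam β γ).IsSteadyState N T_L T_R ν → μ = ν) → ∀ μ : (N : ℕ) → ℝ → ℝ → MeasureTheory.Measure (Literature.MathematicalPhysics.KineticTheory.HeatConduction.PhaseSpace N), (∀ (N : ℕ) (T_L T_R : ℝ), 0 < T_L → 0 < T_R → (Literature.MathematicalPhysics.KineticTheory.HeatConduction.pinnedChain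 ω₂ lam β γ).IsSteadyState N T_L T_R (μ N T_L T_R)) → ∀ T : ℝ, 0 < T → ∀ D : ℕ → ℝ, (∀ N : ℕ, Filter.Tendsto (fun δ : ℝ => (Literature.MathematicalPhysics.KineticTheory.HeatConduction.pinnedChain ω₂ lam β γ).totalCurrent (μ N (T + δ / 2) (T - δ / 2)) / δ) (nhdsWithin 0 {(0 : ℝ)}ᶜ) (nhds (D N))) → BddAbove (Set.range fun N => |D N|) → ∃ k : ℝ, 0 < k ∧ Filter.Tendsto D Filter.atTop (nhds k)

/-- item stmt-AtomisticToContinuum-12073 · crux (kind.auto-crux: conjecture-grade) · rank 9 · open · by planner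
why it might fail: auto-crux — conjecture-grade statement (docstring avows it ('Open problem')); it is open, so it may simply be false
sources: FritzFunakiLebowitz1994, Bernardin2014, SpohnLebowitz1977, Mazur1969, Zotos2002
[support] ZERO-CURRENT (ODD-SECTOR) RIGIDITY OF THE INFINITE CHAIN — the rigidity input of
LocalOhm's planned split and the line's kill test (a); NOT consumed by `closes` (re-ranked from crux
to support after the gen-0 review). For ω₂, lam, β > 0 (γ inert), every probability measure ν on
(ℝ×ℝ)^ℤ that is shift-invariant, time-invariant for the infinite deterministic pinned chain in the
generator sense (∫𝒜f dν = 0, f ∈ C₀¹, 𝒜f ν-integrable) and regular (box relative entropy ≤ C|Λ|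
w.r.t. a Gibbs state) — decls IsShiftInvariant / IsTimeInvariant / IsRegular of
Literature.MathematicalPhysics.KineticTheory.InfiniteChainInvariantStates (fact-free vocabulary) —
and integrates j_0 = bondCurrentZ σ 0, has ∫ j_0 dν = 0. Verbatim the consequent of
CurrentTiltQuench.OddRigidityTransfer (so a proof of CurrentTiltQuench.BoundedOddRigidity closes
it); strictly weaker than MacroErgodicityHypothesis (odd sector only); false at lam = β = 0
(SpohnLebowitz1977). Open problem; idle provers should NOT start here. [difficulty: open-problem] -/
@[route_item "route-AtomisticToContinuum-LocalOhmBV"]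
def ZeroCurrentRigidity : Prop :=
  ∀ ω₂ lam β γ : ℝ, 0 < ω₂ → 0 < lam → 0 < β → ∀ ν : MeasureTheory.Measure Literature.MathematicalPhysics.KineticTheory.HeatConduction.ChainConfig, MeasureTheory.IsProbabilityMeasure ν → Literature.MathematicalPhysics.KineticTheory.HeatConduction.IsShiftInvariant ν → Literature.MathematicalPhysics.KineticTheory.HeatConduction.IsTimeInvariant (Literature.MathematicalPhysics.KineticTheory.HeatConduction.pinnedChain ω₂ lam β γ) ν → Literature.MathematicalPhysics.KineticTheory.HeatConduction.IsRegular (Literature.MathematicalPhysics.KineticTheory.HeatConduction.pinnedChain ω₂ lam β γ) ν → MeasureTheory.Integrable (fun σ => (Literature.MathematicalPhysics.KineticTheory.HeatConduction.pinnedChain ω₂ lam β γ).bondCurrentZ σ 0) ν → ∫ σ, (Literature.MathematicalPhysics.KineticTheory.HeatConduction.pinnedChain ω₂ lam β γ).bondCurrentZ σ 0 ∂ν = 0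

/-- item stmt-AtomisticToContinuum-0717 · support · rank 9 · closed · proved by Summit.AtomisticToContinuum.FouriersLaw.Theorems.FourierGreenKubo.finiteResponseOfUnique_holds (prover) · by planner
sources: HairerMajda2009, ReyBellet2003, CuneoEckmannHairerReyBellet2018
CONDITIONAL FORM OF 0705 (supersedes it as the prover target; refuters pool-5/g3-0: 0705 stand-alone
quantifies over EVERY steady-state family and is false-prone if weak steady states were non-unique):
assuming UNIQUENESS of weak steady states (IsSteadyState class) for pinnedChain at all N, T_L, T_R >
0, the finite-N linear-response limit D_N(T) = lim_{δ→0, δ≠0} totalCurrent(μ_{N,T+δ/2,T−δ/2})/δ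
exists for every T > 0 and N. Content: differentiability at equilibrium of NESS expectations of the
polynomial currents in the bath temperatures (ReyBellet2003 arXiv:math-ph/0303021 Rem 4.4 (51)–(56)
finite-volume Green–Kubo; HairerMajda2009 arXiv:0909.4313 Thm 2.3 framework — their SDE Thm 4.4
Assumption 5 fails here, so verify Assumptions 1–3 via CEHR2018 (2.5)/Carmona2007 Thm 1.1(iv)
weighted spectral gap). N = 0, 1: totalCurrent ≡ 0, D = 0. Together with 0706 gives 0705. -/
@[route_item "route-AtomisticToContinuum-LocalOhmBV", crux]
def FiniteResponseOfUnique : Prop :=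
  ∀ ω₂ lam β γ : ℝ, 0 < ω₂ → 0 < lam → 0 < β → 0 < γ → (∀ (N : ℕ) (T_L T_R : ℝ), 0 < T_L → 0 < T_R → ∀ μ ν : MeasureTheory.Measure (Literature.MathematicalPhysics.KineticTheory.HeatConduction.PhaseSpace N), (Literature.MathematicalPhysics.KineticTheory.HeatConduction.pinnedChain ω₂ lam β γ).IsSteadyState N T_L T_R μ → (Literature.MathematicalPhysics.KineticTheory.HeatConduction.pinnedChain ω₂ lam β γ).IsSteadyState N T_L T_R ν → μ = ν) → ∀ μ : (N : ℕ) → ℝ → ℝ → MeasureTheory.Measure (Literature.MathematicalPhysics.KineticTheory.HeatConduction.PhaseSpace N), (∀ (N : ℕ) (T_L T_R : ℝ), 0 < T_L → 0 < T_R → (Literature.MathematicalPhysics.KineticTheory.HeatConduction.pinnedChain ω₂ lam β γ).IsSteadyState N T_L T_R (μ N T_L T_R)) → ∀ T : ℝ, 0 < T → ∀ N : ℕ, ∃ D : ℝ, Filter.Tendsto (fun δ : ℝ => (Literature.MathematicalPhysics.KineticTheory.HeatConduction.pinnedChain ω₂ lam β γ).totalCurrent (μ N (T + δ / 2) (T -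 δ / 2)) / δ) (nhdsWithin 0 {(0 : ℝ)}ᶜ) (nhds D)

/-- `FiniteResponseOfUnique` holds: proved by `Summit.AtomisticToContinuum.FouriersLaw.Theorems.FourierGreenKubo.finiteResponseOfUnique_holds`. -/
theorem FiniteResponseOfUnique_holds : FiniteResponseOfUnique := _root_.Summit.AtomisticToContinuum.FouriersLaw.Theorems.FourierGreenKubo.finiteResponseOfUnique_holds

/-- item stmt-AtomisticToContinuum-0741 · support · rank 9 · closed · proved by Summit.AtomisticToContinuum.FouriersLaw.Theorems.nessUnique_proof (prover) · by planner
sources: CuneoEckmannHairerReyBellet2018, Carmona2007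
[crux] UNIQUENESS OF THE WEAK STEADY STATE (the half of stmt-0706 not covered by the landed fact
Literature.MathematicalPhysics.KineticTheory.HeatConduction.CuneoEckmannHairerReyBellet2018_pinnedChain,
p3544): for pinnedChain ω₂ lam β γ (all > 0), every N and T_L, T_R > 0, any two measures in the weak
Fokker–Planck class IsSteadyState (probability, ∫ L f dμ = 0 for f ∈ C_c^∞, bond currents
integrable) coincide. Print: uniqueness of the INVARIANT MEASURE of the Langevin semigroup
(CuneoEckmannHairerReyBellet2018 Thm 2.13(1): C1, C2, CA; Carmona2007 Thm 1.1(iii)); the item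
additionally needs 'weak stationary probability solution of L*μ = 0 ⇒ P_t-invariant' for this
hypoelliptic L with cubic drift (Echeverría 1982 well-posed martingale problem on C_c^∞ +
non-explosion via e^{θH}; Bogachev–Krylov–Röckner–Shaposhnikov 2015 Ch. 5 is non-degenerate only) —
the FP-identification lemma is the formal crux. N = 0: PhaseSpace 0 is a point (unique probability
measure); N = 1: both baths on site 0, OU at temperature (T_L+T_R)/2. This is exactly the hypothesis
of FiniteResponse and ThermodynamicLimit and, with the fact, gives clause (i) of FouriersLawFor. -/
@[route_item "route-AtomisticToContinuum-LocalOhmBV", crux]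
def NessUnique : Prop :=
  ∀ ω₂ lam β γ : ℝ, 0 < ω₂ → 0 < lam → 0 < β → 0 < γ → ∀ (N : ℕ) (T_L T_R : ℝ), 0 < T_L → 0 < T_R → ∀ μ ν : MeasureTheory.Measure (Literature.MathematicalPhysics.KineticTheory.HeatConduction.PhaseSpace N), (Literature.MathematicalPhysics.KineticTheory.HeatConduction.pinnedChain ω₂ lam β γ).IsSteadyState N T_L T_R μ → (Literature.MathematicalPhysics.KineticTheory.HeatConduction.pinnedChain ω₂ lam β γ).IsSteadyState N T_L T_R ν → μ = ν

/-- `NessUnique` holds: proved by `Summit.AtomisticToContinuum.FouriersLaw.Theorems.nessUnique_proof`. -/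
theorem NessUnique_holds : NessUnique := _root_.Summit.AtomisticToContinuum.FouriersLaw.Theorems.nessUnique_proof

/-- item stmt-AtomisticToContinuum-10924 · support · rank 9 · open · by planner
sources: BonettoLebowitzReyBellet2000, BonettoLebowitzLukkarinenOlla2009, Literature.Barriers.AtomisticToContinuum.hasBoundedResponse_iff_of_unique
[support] (= the catalogued necessary waypoint
`Literature.Barriers.AtomisticToContinuum.HasBoundedResponse (pinnedChain ω₂ lam β γ)` under
weak-NESS uniqueness, WRITTEN OUT — definiens verbatim, `hasBoundedResponse_iff` is `Iff.rfl`, so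
the old and new decls are definitionally equal (planner Sketch.lean: `example : BoundedResponseR ↔
BoundedResponse := Iff.rfl`, rc 0); provers may still go through `hasBoundedResponse_iff_of_unique`
(PROVED) by importing FixedLengthNoConductivityControl in their Theorems file) for all parameters >
0, assuming uniqueness of weak steady states (IsSteadyState class), along EVERY steady-state family
μ and every T > 0: if D_N = lim_{δ→0, δ≠0} totalCurrent(μ_{N,T+δ/2,T−δ/2})/δ exists for all N then
(|D_N|)_N is bounded — BLR2000 §6.3's missing 'dependence of D on L' in its weakest quantitative
form; closed in this route by OddSufficiency from OddResponseBound (one Cauchy–Schwarz). Cone repair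
2026-08-15 (rev 3): the Barriers PREDICATE carried [cite] doc tags and no `_holds` (it is
vocabulary, explicit binder P), so the staffability audit (#h21_route_deps) listed it as an unproved
cite-only dependency; unfolding removes the name from the decl cone without -/
@[route_item "route-AtomisticToContinuum-LocalOhmBV", crux]
def BoundedResponse : Prop :=
  ∀ ω₂ lam β γ : ℝ, 0 < ω₂ → 0 < lam → 0 < β → 0 < γ → (∀ (N : ℕ) (T_L T_R : ℝ), 0 < T_L → 0 < T_R → ∀ μ ν : MeasureTheory.Measure (Literature.MathematicalPhysics.KineticTheory.HeatConduction.PhaseSpace N), (Literature.MathematicalPhysics.KineticTheory.HeatConduction.pinnedChain ω₂ lam β γ).IsSteadyState N T_L T_R μ → (Literature.MathematicalPhysics.KineticTheory.HeatConduction.pinnedChain ω₂ lam β γ).IsSteadyState N T_L T_R ν → μ = ν) → ∀ μ : (N : ℕ) → ℝ → ℝ → MeasureTheory.Measure (Literature.MathematicalPhysics.KineticTheory.HeatConduction.PhaseSpace N), (∀ (N : ℕ) (T_L T_R : ℝ), 0 < T_L → 0 < T_R → (Literature.MathematicalPhysics.KineticTheory.HeatConduction.pinnedChain ω₂ lam β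 γ).IsSteadyState N T_L T_R (μ N T_L T_R)) → ∀ T : ℝ, 0 < T → ∀ D : ℕ → ℝ, (∀ N : ℕ, Filter.Tendsto (fun δ : ℝ => (Literature.MathematicalPhysics.KineticTheory.HeatConduction.pinnedChain ω₂ lam β γ).totalCurrent (μ N (T + δ / 2) (T - δ / 2)) / δ) (nhdsWithin 0 {(0 : ℝ)}ᶜ) (nhds (D N))) → BddAbove (Set.range fun N => |D N|)

/-- item stmt-AtomisticToContinuum-12011 · support · rank 9 · closed · proved by Summit.AtomisticToContinuum.FouriersLaw.Theorems.PuiseuxTransferLedgerFiniteResponseProfile.finiteResponseProfile_proof (prover) · by planner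
sources: HairerMajda2009, ReyBellet2003, BonettoLebowitzReyBellet2000
[support] [shared, stmt-AtomisticToContinuum-2742] under weak-NESS uniqueness, for every
steady-state family, T > 0, N and site i, the profile difference quotient (μ_{N,T+δ/2,T−δ/2}(p_i²) −
μ_{N,T,T}(p_i²))/δ has a limit θ_N(i) as δ → 0, δ ≠ 0 (same differentiability, observable p_i²;
needed to instantiate θ_N in MonotoneProfile / LocalOhm / BVProfile). [difficulty: M] -/
@[route_item "route-AtomisticToContinuum-LocalOhmBV", crux]
def FiniteResponseProfile : Prop :=
  ∀ ω₂ lam β γ : ℝ, 0 < ω₂ → 0 < lam → 0 < β → 0 < γ → (∀ (N : ℕ) (T_L T_R : ℝ), 0 < T_L → 0 < T_R → ∀ μ ν : MeasureTheory.Measure (Literature.MathematicalPhysics.KineticTheory.HeatConduction.PhaseSpace N), (Literature.MathematicalPhysics.KineticTheory.HeatConduction.pinnedChain ω₂ lam β γ).IsSteadyState N T_L T_R μ → (Literature.MathematicalPhysics.KineticTheory.HeatConduction.pinnedChain ω₂ lam β γ).IsSteadyState N T_L T_R ν → μ = ν) → ∀ μ : (N : ℕ) → ℝ → ℝ → MeasureTheory.Measure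 (Literature.MathematicalPhysics.KineticTheory.HeatConduction.PhaseSpace N), (∀ (N : ℕ) (T_L T_R : ℝ), 0 < T_L → 0 < T_R → (Literature.MathematicalPhysics.KineticTheory.HeatConduction.pinnedChain ω₂ lam β γ).IsSteadyState N T_L T_R (μ N T_L T_R)) → ∀ T : ℝ, 0 < T → ∀ (N : ℕ) (i : Fin N), ∃ t : ℝ, Filter.Tendsto (fun δ : ℝ => ((∫ x, (x.2 i) ^ 2 ∂(μ N (T + δ / 2) (T - δ / 2))) - ∫ x, (x.2 i) ^ 2 ∂(μ N T T)) / δ) (nhdsWithin 0 {(0 : ℝ)}ᶜ) (nhds t)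

/-- `FiniteResponseProfile` holds: proved by `Summit.AtomisticToContinuum.FouriersLaw.Theorems.PuiseuxTransferLedgerFiniteResponseProfile.finiteResponseProfile_proof`. -/
theorem FiniteResponseProfile_holds : FiniteResponseProfile := _root_.Summit.AtomisticToContinuum.FouriersLaw.Theorems.PuiseuxTransferLedgerFiniteResponseProfile.finiteResponseProfile_proof

/-- item stmt-AtomisticToContinuum-12072 · support · rank 9 · closed · proved by Summit.AtomisticToContinuum.FouriersLaw.Theorems.localOhmGlue_proof (prover) · by planner
sources: folklore, BonettoLebowitzReyBellet2000
[support] GLUE (finite sums, ~60 Lean lines; the ONE sufficiency the deciding theorem consumes):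
FiniteResponseProfile → LocalOhm → BVProfile → BoundedResponse. Given parameters, uniqueness, a
family μ, T > 0 and response coefficients D with the clause-(ii) limits: pick θ_N from
FiniteResponseProfile (choice over i : Fin N); from LocalOhm get C, ℓ, b; for N ≥ 4b + 2 sum the
LocalOhm inequality over the bulk bonds x = b, …, N−b−2: (N−2b−1)|D_N|/(N−1) ≤ C Σ_x Σ_{|i−x|≤ℓ}
|θ_N(i+1) − θ_N(i)| ≤ max(C,0)(2ℓ+1) Σ_i |θ_N(i+1) − θ_N(i)| ≤ max(C,0)(2ℓ+1)·C_BV (each bond lies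
in at most 2ℓ+1 windows; BVProfile), hence |D_N| ≤ 2 max(C,0)(2ℓ+1) C_BV; the finitely many N < 4b +
2 contribute a finite maximum; so BddAbove (range |D_N|). Arithmetic re-derived by two refuter
reviews of the gen-0 filing. [difficulty: provable-now] -/
@[route_item "route-AtomisticToContinuum-LocalOhmBV", crux]
def LocalOhmGlue : Prop :=
  FiniteResponseProfile → LocalOhm → BVProfile → BoundedResponse

/-- item stmt-AtomisticToContinuum-12074 · support · rank 9 · open · by planner
sources: Yamilov2006, book:clarkson1999-symmetries-integrability-difference-equations, doi:10.1090/crmm/038, doi:10.1063/1.532230, Mazur1969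
[support] NO LOCAL CONSERVATION LAW BESIDES ENERGY (card support 4; the certificate closing Mazur's
loophole at the local level and the certified form of kill test (b); NOT consumed by `closes`): for
ω₂, lam, β > 0, every smooth local density f on (ℝ×ℝ)^ℤ (f = g ∘ boxRestrict R, g ∈ C^∞) whose
Liouville derivative is a total difference, liouvilleZ P f = ψ − ψ ∘ shift with ψ smooth local, is
of the form c·e_0 + (h − h ∘ shift) + k with e_0 = p_0²/2 + U(q_0) + V(q_1 − q_0), h smooth local,
c, k constants. Method: the symmetry approach to Toda-type lattices u_{n,tt} = F(u_{n−1}, u_n,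
u_{n+1}) (Levi 1999 class (1.1), Thms 1–3 p. 271; Yamilov2006; Levi–Winternitz–Yamilov 2022): a
conservation law of order ≥ 3 forces the canonical conditions, and the first one, (4.9) 'D_t log
∂F/∂u_{n+1} ∈ Im(D−1)', FAILS for V″(r) = 1 + 3βr² (planner hand computation: momentum Euler
derivative φ(r_{n−1}) − φ(r_n) ≢ 0, φ = (log V″)′); orders ≤ 2 by direct computation (pinning kills
momentum; quadratic densities reduce to the harmonic case). Vocabulary: boxRestrict / shift /
liouvilleZ of InfiniteChainInvariantStates. False at lam = β = 0 (infinitely many quadratic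
conservation laws). [difficulty: L] -/
@[route_item "route-AtomisticToContinuum-LocalOhmBV", crux]
def NoLocalIntegrals : Prop :=
  ∀ ω₂ lam β γ : ℝ, 0 < ω₂ → 0 < lam → 0 < β → ∀ f : Literature.MathematicalPhysics.KineticTheory.HeatConduction.ChainConfig → ℝ, (∃ (R : ℕ) (g : (Fin (2 * R + 1) → ℝ × ℝ) → ℝ), ContDiff ℝ ((⊤ : ℕ∞) : WithTop ℕ∞) g ∧ f = g ∘ Literature.MathematicalPhysics.KineticTheory.HeatConduction.boxRestrict R) → (∃ ψ : Literature.MathematicalPhysics.KineticTheory.HeatConduction.ChainConfig → ℝ, (∃ (R : ℕ) (g : (Fin (2 * R + 1) → ℝ × ℝ) → ℝ), ContDiff ℝ ((⊤ : ℕ∞) : WithTop ℕ∞) g ∧ ψ = g ∘ Literature.MathematicalPhysics.KineticTheory.HeatConduction.boxRestrict R) ∧ ∀ σ, Literature.MathematicalPhysics.KineticTheory.HeatConduction.liouvilleZ (Literature.MathematicalPhysics.KineticTheory.HeatConduction.pinnedChain ω₂ lam β γ) f σ = ψ σ - ψ (Literature.MathematicalPhysics.KineticTheory.HeatConduction.shift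 σ)) → ∃ (c k : ℝ) (h : Literature.MathematicalPhysics.KineticTheory.HeatConduction.ChainConfig → ℝ), (∃ (R : ℕ) (g : (Fin (2 * R + 1) → ℝ × ℝ) → ℝ), ContDiff ℝ ((⊤ : ℕ∞) : WithTop ℕ∞) g ∧ h = g ∘ Literature.MathematicalPhysics.KineticTheory.HeatConduction.boxRestrict R) ∧ ∀ σ, f σ = c * ((σ 0).2 ^ 2 / 2 + (Literature.MathematicalPhysics.KineticTheory.HeatConduction.pinnedChain ω₂ lam β γ).U (σ 0).1 + (Literature.MathematicalPhysics.KineticTheory.HeatConduction.pinnedChain ω₂ lam β γ).V ((σ 1).1 - (σ 0).1)) + (h σ - h (Literature.MathematicalPhysics.KineticTheory.HeatConduction.shift σ)) + k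

/-- item stmt-AtomisticToContinuum-9900 · support · rank 9 · closed · proved by Summit.AtomisticToContinuum.FouriersLaw.Theorems.pinnedSteadyStateExists_proof @ 93199528ccef (prover) · by planner
sources: CuneoEckmannHairerReyBellet2018, decl Literature.MathematicalPhysics.KineticTheory.HeatConduction.pinnedChain_exists_isSteadyState
[support] CLAUSE (i) EXISTENCE FOR THE CONJUNCT'S CHAIN (route-repair 2026-08-15, cone bookkeeping;
provable now; kind support, rank 9): for pinnedChain ω₂ lam β γ with ω₂, lam, β, γ > 0, every N and
all T_L, T_R > 0 there is a weak (Fokker–Planck) steady state (OscillatorChain.IsSteadyState).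
PROVED in tree:
Literature.MathematicalPhysics.KineticTheory.HeatConduction.pinnedChain_exists_isSteadyState
(LangevinChainNESSHolds.lean; the discharged fact CuneoEckmannHairerReyBellet2018_pinnedChain for N
≥ 1 + OscillatorChain.isSteadyState_zero for N = 0) — a Theorems file importing the route file +
LangevinChainNESSHolds closes it in one line (evidence file attached:
PinnedSteadyStateExistsProof.lean, rc 0, axioms propext/Classical.choice/Quot.sound). WHY AN ITEM:
it lets the deciding theorem 'closes' take clause (i) existence as a hypothesis, so that the Theses
file can drop the import Literature.MathematicalPhysics.KineticTheory.LangevinChainNESSHolds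
(≈55-module Langevin-SDE cone with the two undischarged Kolmogorov–Chentsov Hölder facts) — the
pending route-repair edit (imports := [InfiniteChainDynamics], closes re-proved, Assembly restated;
package attached as evidence to the route -/
@[route_item "route-AtomisticToContinuum-LocalOhmBV", crux]
def PinnedSteadyStateExists : Prop :=
  ∀ ω₂ lam β γ : ℝ, 0 < ω₂ → 0 < lam → 0 < β → 0 < γ → ∀ (N : ℕ) (T_L T_R : ℝ), 0 < T_L → 0 < T_R → ∃ μ : MeasureTheory.Measure (Literature.MathematicalPhysics.KineticTheory.HeatConduction.PhaseSpace N), (Literature.MathematicalPhysics.KineticTheory.HeatConduction.pinnedChain ω₂ lam β γ).IsSteadyState N T_L T_R μ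

/-- `PinnedSteadyStateExists` holds: proved by `Summit.AtomisticToContinuum.FouriersLaw.Theorems.pinnedSteadyStateExists_proof` @ 93199528ccef. -/
theorem PinnedSteadyStateExists_holds : PinnedSteadyStateExists := _root_.Summit.AtomisticToContinuum.FouriersLaw.Theorems.pinnedSteadyStateExists_proof

-- earlier Assembly (stmt-AtomisticToContinuum-12075, replaced 2026-08-15T20:08:28Z -> stmt-AtomisticToContinuum-13899): retired by None — NessUnique → FiniteResponseOfUnique → FiniteResponseProfile → LocalOhm → BVProfile → BoundedResponseConverges → _root_.FouriersLaw
/-- item stmt-AtomisticToContinuum-13899 · assembly · rank 1 · closed · proved by Summit.AtomisticToContinuum.FouriersLaw.Theorems.localOhmBV_assembly_proof (prover) · by planner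
sources: BonettoLebowitzReyBellet2000, Literature.MathematicalPhysics.KineticTheory.HeatConduction.pinnedChain_exists_isSteadyState
[assembly] NessUnique → PinnedSteadyStateExists → FiniteResponseOfUnique → FiniteResponseProfile →
LocalOhm → BVProfile → BoundedResponseConverges → FouriersLaw (follows from LocalOhmGlue by the
logic of `closes`; restated 2026-08-15 (cone repair) with the clause-(i) existence item
PinnedSteadyStateExists as second antecedent, matching the re-proved `closes`).
[BonettoLebowitzReyBellet2000, CuneoEckmannHairerReyBellet2018] -/
@[route_item "route-AtomisticToContinuum-LocalOhmBV"]
def Assembly : Prop :=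
  NessUnique → PinnedSteadyStateExists → FiniteResponseOfUnique → FiniteResponseProfile → LocalOhm → BVProfile → BoundedResponseConverges → _root_.FouriersLaw

/-! D-0027 §2.1 — DECIDING THEOREM (planner-authored via `route open/edit --closes-file`; by planner-rrepair-AtomisticToContinuum-LocalOhmB-5f5af5d6-g2-0 2026-08-15T20:08:28Z):
its hypotheses are this route's items and its conclusion the sub-problem Statement (glue_lint), and it elaborates with this file. -/

/-- D-0027 §2.1 deciding theorem for route LocalOhmBV (card conservation-law-rigidity-local-ohm, planner gen 2; cone repair
2026-08-15 by the route-repair seat g2): the route's items imply the sub-problem Statement `FouriersLaw`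
(Summits/AtomisticToContinuum/FouriersLaw/Statement.lean). The glue item `LocalOhmGlue` turns FiniteResponseProfile + LocalOhm +
BVProfile into BoundedResponse (length-uniform boundedness of the response coefficients along every steady-state family, under
uniqueness; finite sums); clause (i) from the support item `PinnedSteadyStateExists` (shared stmt-AtomisticToContinuum-9900, clause-(i)
existence, PROVED in tree as `pinnedChain_exists_isSteadyState` — taken as a hypothesis so that this Theses file no longer imports the
Langevin-SDE proof cone `LangevinChainNESSHolds`) + `NessUnique`; canonical family by choice; D₀ from FiniteResponseOfUnique; bounded ⇒
convergent to a positive limit by the import slot BoundedResponseConverges; κ := that limit; any other family has the same difference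
quotients for |δ| < 2T by uniqueness. (planner ConeProbe3.lean: lean check rc 0, axioms propext / Classical.choice / Quot.sound) -/
@[closes "route-AtomisticToContinuum-LocalOhmBV"] theorem closes (hG : LocalOhmGlue) (hNU : NessUnique) (hEX : PinnedSteadyStateExists) (hFR : FiniteResponseOfUnique)
    (hFP : FiniteResponseProfile) (hLO : LocalOhm) (hBV : BVProfile)
    (hBC : BoundedResponseConverges) : _root_.FouriersLaw := by
  show Literature.MathematicalPhysics.KineticTheory.HeatConduction.FouriersLaw
  intro ω₂ lam β γ hω hl hβ hγ
  have hUq := hNU ω₂ lam β γ hω hl hβ hγ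
  -- bounded response along every steady-state family (item `BoundedResponse`, via the glue item `LocalOhmGlue`)
  have hB := hG hFP hLO hBV ω₂ lam β γ hω hl hβ hγ hUq
  -- clause (i) existence: the support item `PinnedSteadyStateExists`
  have hex : ∀ (N : ℕ) (T_L T_R : ℝ), 0 < T_L → 0 < T_R →
      ∃ μ : MeasureTheory.Measure (Literature.MathematicalPhysics.KineticTheory.HeatConduction.PhaseSpace N),
        (Literature.MathematicalPhysics.KineticTheory.HeatConduction.pinnedChain ω₂ lam β γ).IsSteadyState N T_L T_R μ :=
    fun N T_L T_R h1 h2 => hEX ω₂ lam β γ hω hl hβ hγ N T_L T_R h1 h2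
  refine ⟨fun N T_L T_R h1 h2 => ?_, ?_⟩
  · obtain ⟨μ, hμ⟩ := hex N T_L T_R h1 h2
    exact ⟨μ, hμ, fun ν hν => hUq N T_L T_R h1 h2 ν μ hν hμ⟩
  classical
  let μ₀ : (N : ℕ) → ℝ → ℝ →
      MeasureTheory.Measure (Literature.MathematicalPhysics.KineticTheory.HeatConduction.PhaseSpace N) :=
    fun N T_L T_R => if h : 0 < T_L ∧ 0 < T_R then Classical.choose (hex N T_L T_R h.1 h.2) else 0
  have hμ₀ : ∀ (N : ℕ) (T_L T_R : ℝ), 0 < T_L → 0 < T_R →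
      (Literature.MathematicalPhysics.KineticTheory.HeatConduction.pinnedChain ω₂ lam β γ).IsSteadyState N T_L T_R
        (μ₀ N T_L T_R) := by
    intro N T_L T_R h1 h2
    have h12 : 0 < T_L ∧ 0 < T_R := ⟨h1, h2⟩
    simp only [μ₀, dif_pos h12]
    exact Classical.choose_spec (hex N T_L T_R h1 h2)
  have hD : ∀ T : ℝ, 0 < T → ∀ N : ℕ, ∃ D : ℝ,
      Filter.Tendsto (fun δ : ℝ =>
        (Literature.MathematicalPhysics.KineticTheory.HeatConduction.pinnedChain ω₂ lam β γ).totalCurrent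
          (μ₀ N (T + δ / 2) (T - δ / 2)) / δ) (nhdsWithin 0 {(0 : ℝ)}ᶜ) (nhds D) :=
    fun T hT N => hFR ω₂ lam β γ hω hl hβ hγ hUq μ₀ hμ₀ T hT N
  let D₀ : ℝ → ℕ → ℝ := fun T N => if hT : 0 < T then Classical.choose (hD T hT N) else 0
  have hD₀ : ∀ T : ℝ, 0 < T → ∀ N : ℕ,
      Filter.Tendsto (fun δ : ℝ =>
        (Literature.MathematicalPhysics.KineticTheory.HeatConduction.pinnedChain ω₂ lam β γ).totalCurrent
          (μ₀ N (T + δ / 2) (T - δ / 2)) / δ) (nhdsWithin 0 {(0 : ℝ)}ᶜ) (nhds (D₀ T N)) := by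
    intro T hT N
    simp only [D₀, dif_pos hT]
    exact Classical.choose_spec (hD T hT N)
  have hbdd : ∀ T : ℝ, 0 < T → BddAbove (Set.range fun N => |D₀ T N|) :=
    fun T hT => hB μ₀ hμ₀ T hT (D₀ T) (hD₀ T hT)
  have hconv : ∀ T : ℝ, 0 < T → ∃ k : ℝ, 0 < k ∧ Filter.Tendsto (D₀ T) Filter.atTop (nhds k) :=
    fun T hT => hBC ω₂ lam β γ hω hl hβ hγ hUq μ₀ hμ₀ T hT (D₀ T) (hD₀ T hT) (hbdd T hT)
  let κ : ℝ → ℝ := fun T => if hT : 0 < T then Classical.choose (hconv T hT) else 1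
  refine ⟨κ, fun T hT => ?_, ?_⟩
  · simp only [κ, dif_pos hT]
    exact (Classical.choose_spec (hconv T hT)).1
  intro μ hμ T hT
  refine ⟨D₀ T, fun N => ?_, ?_⟩
  · have key : ∀ᶠ δ in nhdsWithin (0 : ℝ) {(0 : ℝ)}ᶜ,
        (Literature.MathematicalPhysics.KineticTheory.HeatConduction.pinnedChain ω₂ lam β γ).totalCurrent
            (μ₀ N (T + δ / 2) (T - δ / 2)) / δ =
          (Literature.MathematicalPhysics.KineticTheory.HeatConduction.pinnedChain ω₂ lam β γ).totalCurrent
            (μ N (T + δ / 2) (T - δ / 2)) / δ := by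
      have h2 : ∀ᶠ δ in nhds (0 : ℝ), δ < 2 * T := eventually_lt_nhds (by linarith)
      have h2' : ∀ᶠ δ in nhds (0 : ℝ), -(2 * T) < δ := eventually_gt_nhds (by linarith)
      filter_upwards [mem_nhdsWithin_of_mem_nhds h2, mem_nhdsWithin_of_mem_nhds h2'] with δ hlt hgt
      have ha : 0 < T + δ / 2 := by linarith
      have hb : 0 < T - δ / 2 := by linarith
      rw [hUq N _ _ ha hb _ _ (hμ₀ N _ _ ha hb) (hμ N _ _ ha hb)]
    exact (hD₀ T hT N).congr' key
  · simp only [κ, dif_pos hT]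
    exact (Classical.choose_spec (hconv T hT)).2

end Summit.AtomisticToContinuum.FouriersLaw.Theses.LocalOhmBV
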